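import Literature.NumberTheory.LFunctions.CertifiedDirichletLTuringMethod
import HarnessLib

/-!
# Trudgian's improvement of Rumely's Turing-method bound for Dirichlet `L`-functions
# (Math. Comp. 80 (2011), §3: Theorems 3.3 and 3.8)

Topic `Literature/NumberTheory/LFunctions`; namespace `Literature.NumberTheory.LFunctions`, grouping
namespace `Trudgian2011Dirichlet` for the parametric constants. Companion of
`CertifiedDirichletLTuringMethod.lean` (`lfunctionArgS = S(t, χ)`, `rumely1993_theorem2`): the source's
§3 is the Dirichlet-`L` analogue of its §2 (whose `ζ`-statement Thm. 2.2 is the tree's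
`abs_integral_zetaArgS_le_trudgian`, `TuringMethod.lean`), and these are the "Trudgian" constants
referred to by Platt (Math. Comp. 85 (2016), p. 3013, after Thm. 3.3). Statement-first (D-0064):
named facts AS PRINTED (D-0014), no discharge attempted.

Source: T. S. Trudgian, *Improvements to Turing's method*, Math. Comp. **80** (2011) 2259–2279
[Trudgian2011], §3 pp. 2269–2273 (journal pdf held as `paper:url-4f2afd5d56d3` pp. 11–15;
arXiv:0903.1885 = `paper:arxiv-0903.1885`). Setting (§3.2 p. 2269): `χ` primitive of conductor
`Q > 1`, `S(t, χ) = (1/π) arg L(1/2 + it, χ)` by continuous variation along `2 → 2 + it → 1/2 + it`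
— the same function as Rumely's/Booker's `S` (the tree's `lfunctionArgS`, continuation from `+∞`
along the horizontal line: on `Re s ≥ 2` both are the Dirichlet-series logarithm, `|log L(2+it, χ)| ≤
log ζ(2) < π/2`), up to the convention at ordinates of zeros, immaterial under `∫ dt`.

* `Trudgian2011Dirichlet.aConst c d t₀`, `.bConst c d` — the constants (3.17)–(3.18) of Thm. 3.8,
  verbatim: `aπ = (c − ½) log ζ(c) + ∫_c^∞ log ζ − d²(log 4) ζ'(½+d)/ζ(½+d) − ½∫_{2d+1}^∞ log ζ
  + ∫_{½+d}^∞ log ζ − ½∫_{2d+1}^{4d+1} log ζ + ∫_{½+d}^{½+2d} log ζ + 15d²/t₀²`,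
  `2bπ = ½(c − ½)² + d²(log 4 − 1)` (this seat re-evaluated them: `a(5/4,1) = 1.7945`,
  `b(5/4,1) = 0.1062`, `a(1.17,0.88) = 1.9744` at `t₀ = 50`, `b(1.17,0.88) = 0.0833`, matching §3.5).
* `trudgian2011_theorem38` — **Thm. 3.8** (p. 2273): for `t₂ > t₁ > t₀ > 50`, `1 < c ≤ 5/4`,
  `½ < d ≤ 1`: `|∫_{t₁}^{t₂} S(t, χ) dt| ≤ a + b log(Qt₂/2π)`.
* `trudgian2011_theorem33` — **Thm. 3.3** (p. 2270): "If `t₂ > t₁ > t₀`, then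
  `|∫_{t₁}^{t₂} S(t, χ) dt| ≤ 1.975 + 0.084 log(Qt₂/2π)`" — Thm. 3.8 at `(c, d) = (1.17, 0.88)` with
  Rumely's `t₀ = 50` (§3.5: `a(1.17, 0.88) = 1.9744`, `b = 0.0833`, computed with the `15d²/t₀²` term
  at `t₀ = 50` — re-checked here: without it `a = 1.9729`), typed with the frame `50 < t₁ < t₂` of
  Theorems 3.1/3.2/3.8 (`a` decreases in `t₀`, so any `t₀ ∈ (50, t₁)` serves).

`lean search` (2026-08-26): the constants `1.975`, `0.084` and Trudgian's Dirichlet statements occur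
nowhere in the tree (`abs_integral_zetaArgS_le_trudgian` is the `ζ` case, Thm. 2.2).

## References

* [Trudgian2011] T. S. Trudgian, *Improvements to Turing's method*, Math. Comp. 80 (2011), no. 276,
  2259–2279, §3 Theorems 3.1–3.3, 3.8, (3.17)–(3.18), pp. 2269–2273.
* [Rumely1993ERH] R. Rumely, *Numerical computations concerning the ERH*, Math. Comp. 61 (1993),
  Theorem 2 (the triple `(1.8397, 0.1242, 50)`).
* [Platt2016GRH] D. J. Platt, Math. Comp. 85 (2016), §3 Thm. 3.3 and the remark following it.
-/

noncomputable section

open Complex Set MeasureTheory intervalIntegral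
open scoped Real

namespace Literature.NumberTheory.LFunctions

namespace Trudgian2011Dirichlet

/-- `log ζ(σ)` for real `σ > 1` (the integrand of (3.17)). [cite: Trudgian2011, §3 (3.17) p. 2273] -/
def logZeta (σ : ℝ) : ℝ :=
  Real.log (riemannZeta (σ : ℂ)).re

/-- **Trudgian's `a = a(c, d, t₀)` of Theorem 3.8, (3.17) verbatim:**
`aπ = (c − ½) log ζ(c) + ∫_c^∞ log ζ(σ) dσ − d²(log 4) ζ'(½ + d)/ζ(½ + d) − ½ ∫_{2d+1}^∞ log ζ(σ) dσ
+ ∫_{½+d}^∞ log ζ(σ) dσ − ½ ∫_{2d+1}^{4d+1} log ζ(σ) dσ + ∫_{½+d}^{½+2d} log ζ(σ) dσ + 15d²/t₀²`.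
[cite: Trudgian2011, §3 Theorem 3.8 (3.17), p. 2273] -/
def aConst (c d t₀ : ℝ) : ℝ :=
  ((c - 1 / 2) * logZeta c + (∫ σ in Ioi c, logZeta σ) -
      d ^ 2 * Real.log 4 *
        ((deriv riemannZeta ((1 / 2 + d : ℝ) : ℂ)).re / (riemannZeta ((1 / 2 + d : ℝ) : ℂ)).re) -
      1 / 2 * (∫ σ in Ioi (2 * d + 1), logZeta σ) + (∫ σ in Ioi (1 / 2 + d), logZeta σ) -
      1 / 2 * (∫ σ in (2 * d + 1)..(4 * d + 1), logZeta σ) + (∫ σ in (1 / 2 + d)..(1 / 2 + 2 * d), logZeta σ) +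
      15 * d ^ 2 / t₀ ^ 2) / π

/-- **Trudgian's `b = b(c, d)` of Theorem 3.8, (3.18) verbatim:** `2bπ = ½(c − ½)² + d²(log 4 − 1)`.
[cite: Trudgian2011, §3 Theorem 3.8 (3.18), p. 2273] -/
def bConst (c d : ℝ) : ℝ :=
  (1 / 2 * (c - 1 / 2) ^ 2 + d ^ 2 * (Real.log 4 - 1)) / (2 * π)

end Trudgian2011Dirichlet

/-- **Trudgian 2011, Theorem 3.8 (p. 2273), as printed:** for a primitive `χ` of conductor `q > 1`
(setting of §3.2), "If `t₂ > t₁ > t₀ > 50` and `c` and `d` are parameters such that `1 < c ≤ 5/4` and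
`½ < d ≤ 1`, the following estimate holds: `|∫_{t₁}^{t₂} S(t, χ) dt| ≤ a + b log(Qt₂/2π)`", with
`a = Trudgian2011Dirichlet.aConst c d t₀` ((3.17)) and `b = Trudgian2011Dirichlet.bConst c d` ((3.18)).
Proved in the source from Littlewood's lemma (3.4), Rademacher's convexity bound (3.5)–(3.6) and the
Lehman-type lower bound with the improvement Lemma 2.10 (Lemmas 3.6–3.7). `S(t, χ) = lfunctionArgS χ t`
(see the module docstring for the identification of conventions). Not discharged here (size L).
[cite: Trudgian2011, §3 Theorem 3.8, p. 2273] -/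
def trudgian2011_theorem38 : Prop :=
  ∀ (q : ℕ) [NeZero q], 1 < q → ∀ χ : DirichletCharacter ℂ q, χ.IsPrimitive →
    ∀ ⦃c d t₀ t₁ t₂ : ℝ⦄, 1 < c → c ≤ 5 / 4 → 1 / 2 < d → d ≤ 1 → 50 < t₀ → t₀ < t₁ → t₁ < t₂ →
      abs (∫ t in t₁..t₂, lfunctionArgS χ t) ≤
        Trudgian2011Dirichlet.aConst c d t₀ + Trudgian2011Dirichlet.bConst c d * Real.log (q * t₂ / (2 * π))

/-- **Trudgian 2011, Theorem 3.3 (p. 2270), as printed:** "If `t₂ > t₁ > t₀`, then the following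
estimate holds: `|∫_{t₁}^{t₂} S(t, χ) dt| ≤ 1.975 + 0.084 log(Qt₂/2π)`" — Theorem 3.8 at
`(c, d) = (1.17, 0.88)` (§3.5: `a(1.17, 0.88) = 1.9744`, `b(1.17, 0.88) = 0.0833`, evaluated with
Rumely's `t₀ = 50` in the term `15d²/t₀²`; re-evaluated by this seat: `1.9744` with, `1.9729` without
that term), for primitive `χ` of conductor `q > 1`; the triple frame `t₂ > t₁ > t₀ > 50` of Theorems
3.1–3.2/3.8 is rendered as `50 < t₁ < t₂` (`a` is decreasing in `t₀`, any `t₀ ∈ (50, t₁)` serves).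
Improves Rumely's `(1.8397, 0.1242)` (`rumely1993_theorem2`) for `qt₂` large. Not discharged here.
[cite: Trudgian2011, §3 Theorem 3.3, p. 2270] -/
def trudgian2011_theorem33 : Prop :=
  ∀ (q : ℕ) [NeZero q], 1 < q → ∀ χ : DirichletCharacter ℂ q, χ.IsPrimitive →
    ∀ ⦃t₁ t₂ : ℝ⦄, 50 < t₁ → t₁ < t₂ →
      abs (∫ t in t₁..t₂, lfunctionArgS χ t) ≤ 1.975 + 0.084 * Real.log (q * t₂ / (2 * π))

/-! ### Platt's working constants: Math. Comp. 85 (2016), Theorem 5.4 (appended 2026-08-26)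

The JOURNAL version of Platt's paper (Math. Comp. **85** (2016) 3009–3027; AMS pdf held as
`paper:url-20e4f76cdba6`) renumbers the arXiv sections (arXiv:1305.3087 §3 Thms. 3.1–3.3 = journal §5
Thms. 5.1–5.3, pp. 3013–3014; arXiv Thms. 7.1–7.2 = journal Thms. 10.1–10.2, p. 3026 — the tree's
`platt2016_theorem71/72` use the arXiv numbering) and turns the arXiv's "personal communication"
remark after Thm. 3.3 into a theorem: -/

/-- **Platt 2016 (journal), Theorem 5.4 "(Trudgian)", p. 3014, as printed:** "For `T > 50` and
`h > 0`, `|∫_T^{T+h} S_χ(t) dt| ≤ 2.17618 + 0.0679956 log(q(T + h)/2π)`", in the setting of §5 (a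
primitive `χ` of modulus `q`, `S_χ` of Thm. 5.2 = `lfunctionArgS`), introduced by "Trudgian considered
this problem in [Trudgian 2011]. Specifically, applying Theorem 3.8 of that paper with `c = 1.1` and
`d = 0.8` we derive revised constants optimised for `qT` in the region of `10⁸`" and followed by "The
two bounds agree near `qt = 2501` and at `qt = 10⁸` Trudgian's is better by a little more than `0.5`."
So this is `trudgian2011_theorem38` at `(c, d, t₀) = (1.1, 0.8, 50)`: `a(1.1, 0.8, 50) = 2.176177…`,
`b(1.1, 0.8) = 0.0679955…` (re-evaluated by this seat; the journal rounds both UP — the arXiv text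
quotes `2.17618` and `0.0679955`), the constants actually used in the computation behind
`platt2016_theorem71` (journal Thm. 10.1). Reduction to Thm. 3.8 PROVED below modulo the numerical
value of (3.17) (`platt2016_theorem54_of_trudgian2011`; `b(1.1, 0.8) ≤ 0.0679956` is proved outright,
`a` involves `∫ log ζ` and `ζ'/ζ(1.3)` and is not evaluated in the kernel).
[cite: Platt2016GRH, Theorem 5.4 p. 3014 (journal numbering, Math. Comp. 85 (2016))] -/
def platt2016_theorem54 : Prop :=
  ∀ (q : ℕ) [NeZero q], 1 < q → ∀ χ : DirichletCharacter ℂ q, χ.IsPrimitive →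
    ∀ ⦃T h : ℝ⦄, 50 < T → 0 < h →
      abs (∫ t in T..T + h, lfunctionArgS χ t) ≤
        2.17618 + 0.0679956 * Real.log (q * (T + h) / (2 * π))

namespace Trudgian2011Dirichlet

/-- `b(1.1, 0.8) = (0.18 + 0.64 (log 4 − 1))/2π ≤ 0.0679956` (Platt's rounding-up of `0.06799551…`).
[cite: Platt2016GRH, Theorem 5.4 p. 3014] -/
theorem bConst_platt_le : bConst 1.1 0.8 ≤ 0.0679956 := by
  have hlog4 : Real.log 4 = 2 * Real.log 2 := by
    rw [show (4 : ℝ) = 2 ^ 2 by norm_num, Real.log_pow]; norm_num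
  have h2 := Real.log_two_lt_d9
  have hπ := Real.pi_gt_d6
  rw [bConst, hlog4, div_le_iff₀ (by positivity)]
  nlinarith

/-- … and `0.0679955 < b(1.1, 0.8)`: the arXiv's `0.0679955` is a rounding to nearest, the journal's
`0.0679956` the safe rounding. [cite: Platt2016GRH, Theorem 5.4 p. 3014] -/
theorem lt_bConst_platt : 0.0679955 < bConst 1.1 0.8 := by
  have hlog4 : Real.log 4 = 2 * Real.log 2 := by
    rw [show (4 : ℝ) = 2 ^ 2 by norm_num, Real.log_pow]; norm_num
  have h2 := Real.log_two_gt_d9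
  have hπ := Real.pi_lt_d6
  rw [bConst, hlog4, lt_div_iff₀ (by positivity)]
  nlinarith

/-- `a(c, d, t₀)` is non-increasing in `t₀` (its only `t₀`-dependence is `+15d²/t₀²`): for
`50 ≤ t₀`, `a(c, d, t₀) ≤ a(c, d, 50)`. [cite: Trudgian2011, §3 Theorem 3.8 (3.17), p. 2273] -/
theorem aConst_le_aConst_fifty (c d : ℝ) {t₀ : ℝ} (ht₀ : 50 ≤ t₀) :
    aConst c d t₀ ≤ aConst c d 50 := by
  unfold aConst
  have hπ : 0 < π := Real.pi_pos
  have h : 15 * d ^ 2 / t₀ ^ 2 ≤ 15 * d ^ 2 / 50 ^ 2 := by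
    apply div_le_div_of_nonneg_left (by positivity) (by positivity)
    exact pow_le_pow_left₀ (by norm_num) ht₀ 2
  exact div_le_div_of_nonneg_right (by linarith) hπ.le

end Trudgian2011Dirichlet

/-- **Platt's Thm. 5.4 from Trudgian's Thm. 3.8**, as the journal says, modulo the printed numerical
value of (3.17): if `trudgian2011_theorem38` holds and `a(1.1, 0.8, 50) ≤ 2.17618`, then
`platt2016_theorem54` holds (take `t₁ = T`, `t₂ = T + h`, `t₀ = (50 + T)/2 ∈ (50, T)`, use
`a(·, ·, t₀) ≤ a(·, ·, 50)`, `b(1.1, 0.8) ≤ 0.0679956` and `log(q(T + h)/2π) ≥ 0`).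
[cite: Platt2016GRH, Theorem 5.4 p. 3014] -/
theorem platt2016_theorem54_of_trudgian2011 (h38 : trudgian2011_theorem38)
    (ha : Trudgian2011Dirichlet.aConst 1.1 0.8 50 ≤ 2.17618) : platt2016_theorem54 := by
  intro q _ hq χ hχ T h hT hh
  have ht₀ : 50 < (50 + T) / 2 := by linarith
  have ht₀T : (50 + T) / 2 < T := by linarith
  have hmain := h38 q hq χ hχ (c := 1.1) (d := 0.8) (by norm_num) (by norm_num) (by norm_num)
    (by norm_num) ht₀ ht₀T (by linarith : T < T + h)
  have hlog : 0 ≤ Real.log (q * (T + h) / (2 * π)) := by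
    apply Real.log_nonneg
    rw [le_div_iff₀ (by positivity)]
    have hq2 : (2 : ℝ) ≤ q := by exact_mod_cast hq
    have hπ4 : π ≤ 4 := Real.pi_le_four
    nlinarith
  have hA := Trudgian2011Dirichlet.aConst_le_aConst_fifty 1.1 0.8 ht₀.le
  have hB := Trudgian2011Dirichlet.bConst_platt_le
  calc abs (∫ t in T..T + h, lfunctionArgS χ t)
      ≤ Trudgian2011Dirichlet.aConst 1.1 0.8 ((50 + T) / 2) +
          Trudgian2011Dirichlet.bConst 1.1 0.8 * Real.log (q * (T + h) / (2 * π)) := hmain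
    _ ≤ 2.17618 + 0.0679956 * Real.log (q * (T + h) / (2 * π)) := by
        have := mul_le_mul_of_nonneg_right hB hlog
        linarith

/-- On their common range Platt's Thm. 5.4 bound is weaker than Trudgian's Thm. 3.3 bound by at most
`0.20118` and stronger once `log(q t₂/2π) > 12.54…` (`qt₂ ≳ 1.77·10⁶`): the crossover the journal
describes relative to RUMELY's constants is "near `qt = 2501`". Recorded as the elementary comparison
of the two printed lines: `2.17618 + 0.0679956 x ≤ 1.975 + 0.084 x ↔ x ≥ 12.5388…`.
[cite: Platt2016GRH, Theorem 5.4 p. 3014] -/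
theorem platt_le_trudgian33_iff (x : ℝ) :
    2.17618 + 0.0679956 * x ≤ 1.975 + 0.084 * x ↔ 0.20118 / 0.0160044 ≤ x := by
  rw [div_le_iff₀ (by norm_num)]
  constructor <;> intro h <;> linarith

end Literature.NumberTheory.LFunctions

end
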